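import Summits.QuantumFields.YangMills.Theorems.LangevinControlUVOSLegsFromFemtoAndGapStubCollar
import Summits.QuantumFields.YangMills.Theorems.LangevinControlUVOSLegsFromFemtoAndGapStubAssemblyLatticeSums
import Summits.QuantumFields.YangMills.Theorems.LangevinControlUVOSLegsFromFemtoAndGapStubAssemblyUniformBoundPrep
import Literature.MathematicalPhysics.QuantumFieldTheory.GaugeOSData
import Literature.MathematicalPhysics.QuantumFieldTheory.LatticeGaugeProofs
import HarnessLib

/-!
# Smeared lattice correlation sums pass to the thermodynamic limit states (Tannery along the torus-projective family)

HONEST FRAMING (R136 (i) «parallel continuum programme», seat `ym-infvol-p1`, pre-birth helper; bears on the spine route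
`BalabanLadder`, crux `NT` = stmt-QuantumFields-19353 / `UVSeamRec` = stmt-QuantumFields-20043, whose conclusions carry the
non-triviality floors `LowerBounds G r a` on large odd TORI).  Pure soft analysis, kernel-checked; nothing about Yang–Mills
is asserted — `LowerBounds` is a HYPOTHESIS of §4.  Existence half of the continuum programme only; not a gap, not Clay.

CONTENT.  The torus quantities `Q2 G r β L s f g = Σ_{x,y ∈ box L} f(s x) g(s y) Cov_{β,2L+1}(Aₓ, A_y)` and
`Q3 G r β L s f g h` (Theorems/LangevinControlUVOSLegsFromFemtoAndGapDefs) along an odd-torus thermodynamic limit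
`μ ∈ oddTorusLimitPoints r β` (sides `2S_k+1`): the box `box 4 (S k)` exhausts `ℤ⁴`, each covariance / third cumulant of
the (bounded continuous cylinder) action densities converges to its value in `μ`, and the Schwartz weights are absolutely
summable over the lattice — so by dominated convergence for series (Tannery) the torus sums converge to the corresponding
sums over `ℤ⁴ × ℤ⁴` / `(ℤ⁴)³` in the state `μ`, and lower bounds valid on all large tori pass to `μ`.

* §1 `summable_abs_schwartz_lattice` — `Σ_{x ∈ ℤ⁴} |f(s x)| < ∞` for a Schwartz `f` and `s > 0` (Schwartz decay of order 6
  + the tree's `a`-uniform lattice Riemann-sum bound `OSLegsFromFemtoAndGap.sum_decay_le`).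
* §2 `tendsto_finset_sum_mul_of_dominated` — abstract Tannery step: exhausting finite index sets, absolutely summable
  weights, uniformly bounded pointwise convergent coefficients ⇒ the weighted finite sums converge to the weighted series;
  `eventually_mem_box` (the boxes `box 4 (S k)` exhaust `ℤ⁴` when `S_k → ∞`).
* §3 along `IsInfiniteVolumeLimitAlong r.ρ β (2S·) μ`: `tendsto_torusE_dens`, `tendsto_torusCov_dens`,
  `tendsto_torusK3` (expectations, covariances and third cumulants of the action densities converge to their values in
  `μ`), with the uniform bounds `abs_torusCov_dens_le`, `abs_torusK3_le`; hence **`tendsto_Q2`**, **`tendsto_Q3`**: the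
  smeared torus sums converge to `Σ'_{ℤ⁴×ℤ⁴} f g · Cov_μ` resp. `Σ'_{(ℤ⁴)³} f g h · κ₃^μ` (`s > 0`).
* §4 **`lowerBounds_oddTorusLimitPoints`** — `LowerBounds G r a`, `a β > 0` ⟹ the SAME witnesses and `ε` give
  `ε ≤ Σ' θv ⊗ v · Cov_μ` and `ε ≤ |Σ' f ⊗ g ⊗ h · κ₃^μ|` for every `β ≥ β₅` and EVERY `μ ∈ oddTorusLimitPoints r β` — no
  volume threshold left (the bodies of the named forms `InfiniteVolume.Q2State / Q3State / LowerBoundsTL` of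
  `Theorems/BalabanLadderInfVolFloorsDefs.lean`, read raw so that this file does not wait for that definitions file).

References: K. Osterwalder, E. Seiler, Ann. Phys. 110 (1978) §2; E. Seiler, LNP 159 (1982) Ch. 2; Tannery's theorem.
-/

set_option autoImplicit false

noncomputable section

open MeasureTheory Filter Topology Finset
open scoped BigOperators SchwartzMap
open Literature.MathematicalPhysics.QuantumFieldTheory hiding ZdEdge
open Literature.MathematicalPhysics.QuantumLattice
open Literature.Probability.LatticeModels (Site box mem_box)
open Summit.QuantumFields.YangMills.Cruxes.OSLegsFromFemtoAndGap.DlrCollarTransfer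
open Summit.QuantumFields.YangMills.Theorems.OSLegsFromFemtoAndGap (sum_decay_le summable_inv_succ_sq
  mul_norm_le_norm_smul_siteToE)

namespace Summit.QuantumFields.YangMills.Theorems.InfiniteVolume

local notation "E4" => EuclideanSpace ℝ (Fin 4)

/-! ## §1 Schwartz functions are absolutely summable over the scaled lattice -/
section Schwartz

/-- **Lattice summability of Schwartz functions**: for `s > 0` and a Schwartz function `f` on `ℝ⁴`,
`Σ_{x ∈ ℤ⁴} |f(s x)| < ∞`.  Schwartz decay `|f(y)| ≤ M (1 + ‖y‖)⁻⁶`, `‖s x‖ ≥ min(s,1)·‖x‖_∞`, and the tree's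
uniform Riemann-sum bound `Σ_{x ∈ T} a⁴ (1 + a‖x‖)⁻⁶ ≤ 81 Σ (m+1)⁻²` on finite sets (`0 < a ≤ 1`). [folklore] -/
theorem summable_abs_schwartz_lattice (f : 𝓢(E4, ℝ)) {s : ℝ} (hs : 0 < s) :
    Summable fun x : Site 4 => |f (s • siteToE x)| := by
  set s' : ℝ := min s 1 with hs'
  have hs'0 : 0 < s' := lt_min hs one_pos
  have hs'1 : s' ≤ 1 := min_le_right _ _
  have hs's : s' ≤ s := min_le_left _ _
  set M : ℝ := 2 ^ (6, 0).1 * (Finset.Iic (6, 0)).sup (fun m => SchwartzMap.seminorm ℝ m.1 m.2) f with hM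
  have hM0 : 0 ≤ M := by positivity
  -- Schwartz decay of order 6
  have hdecay : ∀ y : E4, |f y| ≤ M * ((1 + ‖y‖) ^ 6)⁻¹ := by
    intro y
    have h := SchwartzMap.one_add_le_sup_seminorm_apply (𝕜 := ℝ) (m := (6, 0)) (k := 6) (n := 0) le_rfl le_rfl f y
    rw [norm_iteratedFDeriv_zero, Real.norm_eq_abs] at h
    have hpos : 0 < (1 + ‖y‖) ^ 6 := by positivity
    rw [← div_eq_mul_inv, le_div_iff₀ hpos, mul_comm]
    exact h
  -- comparison with the lattice weight of the Riemann-sum bound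
  have hcmp : ∀ x : Site 4, |f (s • siteToE x)| ≤ M / s' ^ 4 * (s' ^ 4 * ((1 + s' * ‖x‖) ^ 6)⁻¹) := by
    intro x
    have h1 := hdecay (s • siteToE x)
    have h2 : s' * ‖x‖ ≤ ‖s • siteToE x‖ :=
      (mul_le_mul_of_nonneg_right hs's (norm_nonneg _)).trans (mul_norm_le_norm_smul_siteToE hs.le x)
    have h3 : ((1 + ‖s • siteToE x‖) ^ 6)⁻¹ ≤ ((1 + s' * ‖x‖) ^ 6)⁻¹ := by
      have : 0 < (1 + s' * ‖x‖) ^ 6 := by positivity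
      exact inv_anti₀ this (pow_le_pow_left₀ (by positivity) (by linarith) 6)
    calc |f (s • siteToE x)| ≤ M * ((1 + ‖s • siteToE x‖) ^ 6)⁻¹ := h1
      _ ≤ M * ((1 + s' * ‖x‖) ^ 6)⁻¹ := mul_le_mul_of_nonneg_left h3 hM0
      _ = M / s' ^ 4 * (s' ^ 4 * ((1 + s' * ‖x‖) ^ 6)⁻¹) := by
          field_simp
  refine summable_of_sum_le (fun x => abs_nonneg _) (c := M / s' ^ 4 * (81 * ∑' m : ℕ, (((m : ℝ) + 1) ^ 2)⁻¹))
    fun T => ?_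
  calc ∑ x ∈ T, |f (s • siteToE x)| ≤ ∑ x ∈ T, M / s' ^ 4 * (s' ^ 4 * ((1 + s' * ‖x‖) ^ 6)⁻¹) :=
        Finset.sum_le_sum fun x _ => hcmp x
    _ = M / s' ^ 4 * ∑ x ∈ T, s' ^ 4 * ((1 + s' * ‖x‖) ^ 6)⁻¹ := by rw [Finset.mul_sum]
    _ ≤ M / s' ^ 4 * (81 * ∑' m : ℕ, (((m : ℝ) + 1) ^ 2)⁻¹) :=
        mul_le_mul_of_nonneg_left (sum_decay_le hs'0 hs'1 (p := 6) le_rfl T) (by positivity)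

/-- Pair weights `f(s x) g(s y)` are absolutely summable over `ℤ⁴ × ℤ⁴`. [folklore] -/
theorem summable_abs_pairWeight (f g : 𝓢(E4, ℝ)) {s : ℝ} (hs : 0 < s) :
    Summable fun p : Site 4 × Site 4 => |f (s • siteToE p.1) * g (s • siteToE p.2)| := by
  have h := (summable_abs_schwartz_lattice f hs).mul_of_nonneg (summable_abs_schwartz_lattice g hs)
    (fun _ => abs_nonneg _) (fun _ => abs_nonneg _)
  simpa only [abs_mul] using h

/-- Triple weights `f(s x) g(s y) h(s z)` are absolutely summable over `ℤ⁴ × ℤ⁴ × ℤ⁴`. [folklore] -/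
theorem summable_abs_tripleWeight (f g h : 𝓢(E4, ℝ)) {s : ℝ} (hs : 0 < s) :
    Summable fun p : Site 4 × Site 4 × Site 4 =>
      |f (s • siteToE p.1) * g (s • siteToE p.2.1) * h (s • siteToE p.2.2)| := by
  have h2 := (summable_abs_schwartz_lattice g hs).mul_of_nonneg (summable_abs_schwartz_lattice h hs)
    (fun _ => abs_nonneg _) (fun _ => abs_nonneg _)
  have h3 := (summable_abs_schwartz_lattice f hs).mul_of_nonneg h2 (fun _ => abs_nonneg _)
    (fun _ => mul_nonneg (abs_nonneg _) (abs_nonneg _))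
  simpa only [abs_mul, mul_assoc] using h3

end Schwartz

/-! ## §2 The abstract Tannery step over exhausting finite index sets -/
section Tannery

/-- **Weighted finite sums over exhausting index sets converge to the weighted series** when the weights are absolutely
summable and the coefficients are uniformly bounded and converge pointwise (dominated convergence for series, Mathlib
`tendsto_tsum_of_dominated_convergence`, applied to the zero-extended finite sums). [folklore] -/
theorem tendsto_finset_sum_mul_of_dominated {ι : Type*} [DecidableEq ι] {T : ℕ → Finset ι}
    (hT : ∀ i, ∀ᶠ k in atTop, i ∈ T k) {w : ι → ℝ} (hw : Summable fun i => |w i|) {c : ℕ → ι → ℝ} {cinf : ι → ℝ}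
    {B : ℝ} (hcB : ∀ k i, |c k i| ≤ B) (hc : ∀ i, Tendsto (fun k => c k i) atTop (𝓝 (cinf i))) :
    Tendsto (fun k => ∑ i ∈ T k, w i * c k i) atTop (𝓝 (∑' i, w i * cinf i)) := by
  have hB : ∀ i, 0 ≤ B := fun i => (abs_nonneg _).trans (hcB 0 i)
  -- zero-extend the finite sums
  have hext : ∀ k, ∑ i ∈ T k, w i * c k i = ∑' i, (if i ∈ T k then w i * c k i else 0) := by
    intro k
    rw [tsum_eq_sum (s := T k) (fun i hi => if_neg hi)]
    exact Finset.sum_congr rfl fun i hi => (if_pos hi).symm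
  simp_rw [hext]
  refine tendsto_tsum_of_dominated_convergence (bound := fun i => |w i| * B) (hw.mul_right B) (fun i => ?_) ?_
  · -- pointwise: eventually `i ∈ T k`, then the summand is `w i * c k i → w i * cinf i`
    have h1 : Tendsto (fun k => w i * c k i) atTop (𝓝 (w i * cinf i)) := (hc i).const_mul (w i)
    refine h1.congr' ?_
    filter_upwards [hT i] with k hk
    exact (if_pos hk).symm
  · refine Filter.Eventually.of_forall fun k i => ?_
    by_cases hi : i ∈ T k
    · rw [if_pos hi, Real.norm_eq_abs, abs_mul]
      exact mul_le_mul_of_nonneg_left (hcB k i) (abs_nonneg _)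
    · rw [if_neg hi, norm_zero]
      exact mul_nonneg (abs_nonneg _) (hB i)

/-- The boxes `box 4 (S k)` exhaust `ℤ⁴` when `S_k → ∞`. [folklore] -/
theorem eventually_mem_box {S : ℕ → ℕ} (hS : Tendsto S atTop atTop) (x : Site 4) : ∀ᶠ k in atTop, x ∈ box 4 (S k) := by
  filter_upwards [hS.eventually_ge_atTop (∑ i, (x i).natAbs)] with k hk
  rw [mem_box]
  intro i
  have h1 : (x i).natAbs ≤ ∑ j, (x j).natAbs :=
    Finset.single_le_sum (f := fun j => (x j).natAbs) (fun _ _ => Nat.zero_le _) (Finset.mem_univ i)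
  have h2 : |x i| ≤ (S k : ℤ) := by
    rw [← Int.natCast_natAbs]; exact_mod_cast h1.trans hk
  exact ⟨by linarith [(abs_le.1 h2).1], (abs_le.1 h2).2⟩

end Tannery

/-! ## §3 Expectations, covariances and third cumulants of the action densities along a thermodynamic limit -/

section Limits

variable {G : Type} [Group G] [TopologicalSpace G] [IsTopologicalGroup G] [CompactSpace G]
  [MeasurableSpace G] [BorelSpace G] (r : LatticeRep G)

/-- The action densities are bounded uniformly in the site (they are translates of the bounded species `r.curvature`).
[folklore] -/
theorem exists_abs_dens_le_uniform : ∃ C : ℝ, 0 ≤ C ∧ ∀ (x : Site 4) (U : LGConfig 4 G), |dens G r x U| ≤ C := by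
  obtain ⟨C, hC⟩ := r.curvature.bounded
  exact ⟨max C 0, le_max_right _ _, fun x U => (hC _).trans (le_max_left _ _)⟩

variable {β : ℝ} {S : ℕ → ℕ} {μ : Measure (LGConfig 4 G)}

/-- Along an odd-torus thermodynamic limit, torus expectations of bounded continuous cylinder observables (read through
`torusE`) converge to their expectations in the limit state. [folklore] -/
theorem tendsto_torusE (hμ : IsInfiniteVolumeLimitAlong (d := 4) r.ρ β (fun k => 2 * S k) μ) {F : LGConfig 4 G → ℝ}
    {T : Finset (ZdEdge 4)} (hF : IsCylinder F T) (hFc : Continuous F) (hFb : ∃ C, ∀ U, |F U| ≤ C) :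
    Tendsto (fun k => torusE G r β (S k) F) atTop (𝓝 (∫ U, F U ∂μ)) :=
  hμ.2 F T hF hFc hFb

/-- Expectations of the action densities converge. [folklore] -/
theorem tendsto_torusE_dens (hμ : IsInfiniteVolumeLimitAlong (d := 4) r.ρ β (fun k => 2 * S k) μ) (x : Site 4) :
    Tendsto (fun k => torusE G r β (S k) (dens G r x)) atTop (𝓝 (∫ U, dens G r x U ∂μ)) := by
  obtain ⟨C, -, hC⟩ := exists_abs_dens_le_uniform (G := G) r
  exact tendsto_torusE r hμ (isCylinder_dens r x) (continuous_dens r x) ⟨C, hC x⟩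

/-- Expectations of products of two action densities converge. [folklore] -/
theorem tendsto_torusE_dens_mul (hμ : IsInfiniteVolumeLimitAlong (d := 4) r.ρ β (fun k => 2 * S k) μ) (x y : Site 4) :
    Tendsto (fun k => torusE G r β (S k) (fun U => dens G r x U * dens G r y U)) atTop
      (𝓝 (∫ U, dens G r x U * dens G r y U ∂μ)) := by
  obtain ⟨C, hC0, hC⟩ := exists_abs_dens_le_uniform (G := G) r
  refine tendsto_torusE r hμ (IsCylinder.mul (isCylinder_dens r x) (isCylinder_dens r y))
    ((continuous_dens r x).mul (continuous_dens r y)) ⟨C * C, fun U => ?_⟩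
  rw [abs_mul]; exact mul_le_mul (hC x U) (hC y U) (abs_nonneg _) hC0

/-- Expectations of products of three action densities converge. [folklore] -/
theorem tendsto_torusE_dens_mul_mul (hμ : IsInfiniteVolumeLimitAlong (d := 4) r.ρ β (fun k => 2 * S k) μ)
    (x y z : Site 4) :
    Tendsto (fun k => torusE G r β (S k) (fun U => dens G r x U * dens G r y U * dens G r z U)) atTop
      (𝓝 (∫ U, dens G r x U * dens G r y U * dens G r z U ∂μ)) := by
  obtain ⟨C, hC0, hC⟩ := exists_abs_dens_le_uniform (G := G) r
  refine tendsto_torusE r hμ (IsCylinder.mul (IsCylinder.mul (isCylinder_dens r x) (isCylinder_dens r y))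
    (isCylinder_dens r z))
    (((continuous_dens r x).mul (continuous_dens r y)).mul (continuous_dens r z)) ⟨C * C * C, fun U => ?_⟩
  rw [abs_mul, abs_mul]
  exact mul_le_mul (mul_le_mul (hC x U) (hC y U) (abs_nonneg _) hC0) (hC z U) (abs_nonneg _)
    (mul_nonneg hC0 hC0)

/-- **Covariances of the action densities converge** along the thermodynamic limit. [folklore] -/
theorem tendsto_torusCov_dens (hμ : IsInfiniteVolumeLimitAlong (d := 4) r.ρ β (fun k => 2 * S k) μ) (x y : Site 4) :
    Tendsto (fun k => torusE G r β (S k) (fun U => dens G r x U * dens G r y U) -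
        torusE G r β (S k) (dens G r x) * torusE G r β (S k) (dens G r y)) atTop
      (𝓝 ((∫ U, dens G r x U * dens G r y U ∂μ) - (∫ U, dens G r x U ∂μ) * ∫ U, dens G r y U ∂μ)) :=
  (tendsto_torusE_dens_mul r hμ x y).sub ((tendsto_torusE_dens r hμ x).mul (tendsto_torusE_dens r hμ y))

/-- **Third cumulants of the action densities converge** along the thermodynamic limit. [folklore] -/
theorem tendsto_torusK3 (hμ : IsInfiniteVolumeLimitAlong (d := 4) r.ρ β (fun k => 2 * S k) μ) (x y z : Site 4) :
    Tendsto (fun k => torusK3 G r β (S k) x y z) atTop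
      (𝓝 ((∫ U, dens G r x U * dens G r y U * dens G r z U ∂μ)
        - (∫ U, dens G r x U ∂μ) * (∫ U, dens G r y U * dens G r z U ∂μ)
        - (∫ U, dens G r y U ∂μ) * (∫ U, dens G r x U * dens G r z U ∂μ)
        - (∫ U, dens G r z U ∂μ) * (∫ U, dens G r x U * dens G r y U ∂μ)
        + 2 * ((∫ U, dens G r x U ∂μ) * (∫ U, dens G r y U ∂μ) * ∫ U, dens G r z U ∂μ))) := by
  unfold torusK3
  exact ((((tendsto_torusE_dens_mul_mul r hμ x y z).sub
      ((tendsto_torusE_dens r hμ x).mul (tendsto_torusE_dens_mul r hμ y z))).sub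
      ((tendsto_torusE_dens r hμ y).mul (tendsto_torusE_dens_mul r hμ x z))).sub
      ((tendsto_torusE_dens r hμ z).mul (tendsto_torusE_dens_mul r hμ x y))).add
    ((((tendsto_torusE_dens r hμ x).mul (tendsto_torusE_dens r hμ y)).mul (tendsto_torusE_dens r hμ z)).const_mul 2)

/-- Torus expectations of functions bounded by `C` are bounded by `C` (any `L`). [folklore] -/
theorem abs_torusE_le (β : ℝ) (L : ℕ) {F : LGConfig 4 G → ℝ} {C : ℝ} (hC : ∀ U, |F U| ≤ C) :
    |torusE G r β L F| ≤ C := by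
  haveI : SecondCountableTopology G :=
    (r.continuous.isClosedEmbedding r.injective).isEmbedding.secondCountableTopology
  haveI := isProbabilityMeasure_wilsonMeasure (d := 4) (L := 2 * L + 1) r.ρ r.continuous β
  exact abs_integral_le_of_abs_le fun U => hC _

/-- **Uniform bound on the torus covariances** of the action densities: `≤ 2C²`. [folklore] -/
theorem abs_torusCov_dens_le {C : ℝ} (hC0 : 0 ≤ C) (hC : ∀ (x : Site 4) (U : LGConfig 4 G), |dens G r x U| ≤ C)
    (β : ℝ) (L : ℕ) (x y : Site 4) :
    |torusE G r β L (fun U => dens G r x U * dens G r y U) -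
        torusE G r β L (dens G r x) * torusE G r β L (dens G r y)| ≤ 2 * C ^ 2 := by
  have h1 : |torusE G r β L (fun U => dens G r x U * dens G r y U)| ≤ C * C :=
    abs_torusE_le r β L fun U => by rw [abs_mul]; exact mul_le_mul (hC x U) (hC y U) (abs_nonneg _) hC0
  have h2 : |torusE G r β L (dens G r x) * torusE G r β L (dens G r y)| ≤ C * C := by
    rw [abs_mul]
    exact mul_le_mul (abs_torusE_le r β L (hC x)) (abs_torusE_le r β L (hC y)) (abs_nonneg _) hC0
  calc _ ≤ |torusE G r β L (fun U => dens G r x U * dens G r y U)| +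
        |torusE G r β L (dens G r x) * torusE G r β L (dens G r y)| := abs_sub _ _
    _ ≤ C * C + C * C := add_le_add h1 h2
    _ = 2 * C ^ 2 := by ring

/-- **Uniform bound on the torus third cumulants** of the action densities: `≤ 6C³`. [folklore] -/
theorem abs_torusK3_le {C : ℝ} (hC0 : 0 ≤ C) (hC : ∀ (x : Site 4) (U : LGConfig 4 G), |dens G r x U| ≤ C)
    (β : ℝ) (L : ℕ) (x y z : Site 4) : |torusK3 G r β L x y z| ≤ 6 * C ^ 3 := by
  have hE1 : ∀ w : Site 4, |torusE G r β L (dens G r w)| ≤ C := fun w => abs_torusE_le r β L (hC w)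
  have hE2 : ∀ v w : Site 4, |torusE G r β L (fun U => dens G r v U * dens G r w U)| ≤ C * C := fun v w =>
    abs_torusE_le r β L fun U => by rw [abs_mul]; exact mul_le_mul (hC v U) (hC w U) (abs_nonneg _) hC0
  have hE3 : |torusE G r β L (fun U => dens G r x U * dens G r y U * dens G r z U)| ≤ C * C * C :=
    abs_torusE_le r β L fun U => by
      rw [abs_mul, abs_mul]
      exact mul_le_mul (mul_le_mul (hC x U) (hC y U) (abs_nonneg _) hC0) (hC z U) (abs_nonneg _)
        (mul_nonneg hC0 hC0)
  have hm : ∀ (u v : ℝ) (w₁ w₂ : Site 4) (s : Site 4), u = torusE G r β L (dens G r s) →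
      v = torusE G r β L (fun U => dens G r w₁ U * dens G r w₂ U) → |u * v| ≤ C * (C * C) := by
    intro u v w₁ w₂ s hu hv
    rw [hu, hv, abs_mul]
    exact mul_le_mul (hE1 s) (hE2 w₁ w₂) (abs_nonneg _) hC0
  have h4 : |2 * (torusE G r β L (dens G r x) * torusE G r β L (dens G r y) * torusE G r β L (dens G r z))| ≤
      2 * (C * C * C) := by
    rw [abs_mul, abs_of_pos (two_pos : (0 : ℝ) < 2), abs_mul, abs_mul]
    exact mul_le_mul_of_nonneg_left (mul_le_mul (mul_le_mul (hE1 x) (hE1 y) (abs_nonneg _) hC0) (hE1 z)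
      (abs_nonneg _) (mul_nonneg hC0 hC0)) two_pos.le
  unfold torusK3
  have t1 := hm _ _ y z x rfl rfl
  have t2 := hm _ _ x z y rfl rfl
  have t3 := hm _ _ x y z rfl rfl
  calc _ ≤ |torusE G r β L (fun U => dens G r x U * dens G r y U * dens G r z U)
          - torusE G r β L (dens G r x) * torusE G r β L (fun U => dens G r y U * dens G r z U)
          - torusE G r β L (dens G r y) * torusE G r β L (fun U => dens G r x U * dens G r z U)
          - torusE G r β L (dens G r z) * torusE G r β L (fun U => dens G r x U * dens G r y U)| +
        |2 * (torusE G r β L (dens G r x) * torusE G r β L (dens G r y) * torusE G r β L (dens G r z))| :=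
        abs_add_le _ _
    _ ≤ (C * C * C + C * (C * C) + C * (C * C) + C * (C * C)) + 2 * (C * C * C) := by
        gcongr
        refine (abs_sub _ _).trans (add_le_add ((abs_sub _ _).trans (add_le_add ((abs_sub _ _).trans
          (add_le_add hE3 t1)) t2)) t3)
    _ = 6 * C ^ 3 := by ring

/-- **`Q2` passes to the thermodynamic limit**: along `μ ∈ oddTorusLimitPoints` (sequence `S`), for `s > 0`,
`Q2 G r β (S k) s f g → Σ'_{(x,y) ∈ ℤ⁴×ℤ⁴} f(s x) g(s y) Cov_μ(Aₓ, A_y)`. [folklore] -/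
theorem tendsto_Q2 (hS : StrictMono S) (hμ : IsInfiniteVolumeLimitAlong (d := 4) r.ρ β (fun k => 2 * S k) μ)
    {s : ℝ} (hs : 0 < s) (f g : 𝓢(E4, ℝ)) :
    Tendsto (fun k => Q2 G r β (S k) s f g) atTop
      (𝓝 (∑' p : Site 4 × Site 4, f (s • siteToE p.1) * g (s • siteToE p.2) *
        ((∫ U, dens G r p.1 U * dens G r p.2 U ∂μ) - (∫ U, dens G r p.1 U ∂μ) * ∫ U, dens G r p.2 U ∂μ))) := by
  classical
  obtain ⟨C, hC0, hC⟩ := exists_abs_dens_le_uniform (G := G) r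
  have hQ2 : ∀ k, Q2 G r β (S k) s f g = ∑ p ∈ box 4 (S k) ×ˢ box 4 (S k),
      f (s • siteToE p.1) * g (s • siteToE p.2) *
        (torusE G r β (S k) (fun U => dens G r p.1 U * dens G r p.2 U) -
          torusE G r β (S k) (dens G r p.1) * torusE G r β (S k) (dens G r p.2)) := by
    intro k
    unfold Q2
    rw [Finset.sum_product]
  simp_rw [hQ2]
  refine tendsto_finset_sum_mul_of_dominated (T := fun k => box 4 (S k) ×ˢ box 4 (S k)) (fun p => ?_)
    (summable_abs_pairWeight f g hs) (B := 2 * C ^ 2) (fun k p => abs_torusCov_dens_le r hC0 hC β (S k) p.1 p.2)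
    (fun p => tendsto_torusCov_dens r hμ p.1 p.2)
  filter_upwards [eventually_mem_box hS.tendsto_atTop p.1, eventually_mem_box hS.tendsto_atTop p.2] with k h1 h2
  exact Finset.mem_product.2 ⟨h1, h2⟩

/-- **`Q3` passes to the thermodynamic limit**: along `μ ∈ oddTorusLimitPoints` (sequence `S`), for `s > 0`,
`Q3 G r β (S k) s f g h → Σ'_{(x,y,z) ∈ (ℤ⁴)³} f(s x) g(s y) h(s z) κ₃^μ(Aₓ, A_y, A_z)`. [folklore] -/
theorem tendsto_Q3 (hS : StrictMono S) (hμ : IsInfiniteVolumeLimitAlong (d := 4) r.ρ β (fun k => 2 * S k) μ)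
    {s : ℝ} (hs : 0 < s) (f g h : 𝓢(E4, ℝ)) :
    Tendsto (fun k => Q3 G r β (S k) s f g h) atTop
      (𝓝 (∑' p : Site 4 × Site 4 × Site 4,
        f (s • siteToE p.1) * g (s • siteToE p.2.1) * h (s • siteToE p.2.2) *
          ((∫ U, dens G r p.1 U * dens G r p.2.1 U * dens G r p.2.2 U ∂μ)
            - (∫ U, dens G r p.1 U ∂μ) * (∫ U, dens G r p.2.1 U * dens G r p.2.2 U ∂μ)
            - (∫ U, dens G r p.2.1 U ∂μ) * (∫ U, dens G r p.1 U * dens G r p.2.2 U ∂μ)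
            - (∫ U, dens G r p.2.2 U ∂μ) * (∫ U, dens G r p.1 U * dens G r p.2.1 U ∂μ)
            + 2 * ((∫ U, dens G r p.1 U ∂μ) * (∫ U, dens G r p.2.1 U ∂μ) * ∫ U, dens G r p.2.2 U ∂μ)))) := by
  classical
  obtain ⟨C, hC0, hC⟩ := exists_abs_dens_le_uniform (G := G) r
  have hQ3 : ∀ k, Q3 G r β (S k) s f g h = ∑ p ∈ box 4 (S k) ×ˢ (box 4 (S k) ×ˢ box 4 (S k)),
      f (s • siteToE p.1) * g (s • siteToE p.2.1) * h (s • siteToE p.2.2) * torusK3 G r β (S k) p.1 p.2.1 p.2.2 := by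
    intro k
    unfold Q3
    rw [Finset.sum_product]
    refine Finset.sum_congr rfl fun x _ => ?_
    rw [Finset.sum_product]
  simp_rw [hQ3]
  refine tendsto_finset_sum_mul_of_dominated (T := fun k => box 4 (S k) ×ˢ (box 4 (S k) ×ˢ box 4 (S k)))
    (fun p => ?_) (summable_abs_tripleWeight f g h hs) (B := 6 * C ^ 3)
    (fun k p => abs_torusK3_le r hC0 hC β (S k) p.1 p.2.1 p.2.2) (fun p => tendsto_torusK3 r hμ p.1 p.2.1 p.2.2)
  filter_upwards [eventually_mem_box hS.tendsto_atTop p.1, eventually_mem_box hS.tendsto_atTop p.2.1,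
    eventually_mem_box hS.tendsto_atTop p.2.2] with k h1 h2 h3
  exact Finset.mem_product.2 ⟨h1, Finset.mem_product.2 ⟨h2, h3⟩⟩

end Limits

/-! ## §4 The non-triviality floors pass to the odd-torus thermodynamic limit states -/

section Floors

variable {G : Type} [Group G] [TopologicalSpace G] [IsTopologicalGroup G] [CompactSpace G]
  [MeasurableSpace G] [BorelSpace G] (r : LatticeRep G)

/-- **`LowerBounds` ⟹ the floors in every odd-torus limit state (raw form).**  For a positive unit map `a` and the
k-free torus floors `LowerBounds G r a` (witnesses `v`; `f, g, h`; constants `ε, β₅`): for every `β ≥ β₅` and EVERY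
`μ ∈ oddTorusLimitPoints r β`, `ε ≤ Σ'_{ℤ⁴×ℤ⁴} θv(aβ·x) v(aβ·y) Cov_μ(Aₓ,A_y)` and
`ε ≤ |Σ'_{(ℤ⁴)³} f g h · κ₃^μ|` — the same witnesses and the same `ε`, no volume threshold (along the defining tori the
physical size `a β · S_k` eventually exceeds `Λ₅`, and §3's limits are closed under `≤`).  These are the bodies of
`InfiniteVolume.LowerBoundsTL G r a` (Theorems/BalabanLadderInfVolFloorsDefs.lean). [folklore] -/
theorem lowerBounds_oddTorusLimitPoints {a : ℝ → ℝ} (hapos : ∀ β, 0 < a β) (h : LowerBounds G r a) :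
    (∃ (v : 𝓢(E4, ℝ)) (ε β₅ : ℝ), tsupport v ⊆ {y : E4 | 0 < y 0} ∧ 0 < ε ∧
        ∀ β : ℝ, β₅ ≤ β → ∀ μ ∈ oddTorusLimitPoints r β,
          ε ≤ ∑' p : Site 4 × Site 4, (thetaTest 4 v) (a β • siteToE p.1) * v (a β • siteToE p.2) *
            ((∫ U, dens G r p.1 U * dens G r p.2 U ∂μ) - (∫ U, dens G r p.1 U ∂μ) * ∫ U, dens G r p.2 U ∂μ)) ∧
      (∃ (f g h : 𝓢(E4, ℝ)) (ε β₅ : ℝ), Disjoint (tsupport f) (tsupport g) ∧ Disjoint (tsupport g) (tsupport h) ∧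
        Disjoint (tsupport f) (tsupport h) ∧ 0 < ε ∧
        ∀ β : ℝ, β₅ ≤ β → ∀ μ ∈ oddTorusLimitPoints r β,
          ε ≤ |∑' p : Site 4 × Site 4 × Site 4,
            f (a β • siteToE p.1) * g (a β • siteToE p.2.1) * h (a β • siteToE p.2.2) *
              ((∫ U, dens G r p.1 U * dens G r p.2.1 U * dens G r p.2.2 U ∂μ)
                - (∫ U, dens G r p.1 U ∂μ) * (∫ U, dens G r p.2.1 U * dens G r p.2.2 U ∂μ)
                - (∫ U, dens G r p.2.1 U ∂μ) * (∫ U, dens G r p.1 U * dens G r p.2.2 U ∂μ)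
                - (∫ U, dens G r p.2.2 U ∂μ) * (∫ U, dens G r p.1 U * dens G r p.2.1 U ∂μ)
                + 2 * ((∫ U, dens G r p.1 U ∂μ) * (∫ U, dens G r p.2.1 U ∂μ) * ∫ U, dens G r p.2.2 U ∂μ))|) := by
  obtain ⟨⟨v, ε₂, β₅, Λ₅, hv, hε₂, H2⟩, ⟨f, g, h, ε₃, β₆, Λ₆, hfg, hgh, hfh, hε₃, H3⟩⟩ := h
  -- along the defining tori the physical size eventually exceeds any threshold
  have hsize : ∀ (β Λ : ℝ) {S : ℕ → ℕ}, StrictMono S → ∀ᶠ k in atTop, Λ ≤ a β * (S k : ℕ) := by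
    intro β Λ S hS
    have ht : Tendsto (fun k => a β * ((S k : ℕ) : ℝ)) atTop atTop :=
      (tendsto_natCast_atTop_atTop.comp hS.tendsto_atTop).const_mul_atTop (hapos β)
    exact ht.eventually_ge_atTop Λ
  refine ⟨⟨v, ε₂, β₅, hv, hε₂, fun β hβ μ hμ => ?_⟩, ⟨f, g, h, ε₃, β₆, hfg, hgh, hfh, hε₃, fun β hβ μ hμ => ?_⟩⟩
  · obtain ⟨S, hS, hlim⟩ := hμ
    refine ge_of_tendsto (tendsto_Q2 r hS hlim (hapos β) (thetaTest 4 v) v) ?_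
    filter_upwards [hsize β Λ₅ hS] with k hk
    exact H2 β hβ (S k) hk
  · obtain ⟨S, hS, hlim⟩ := hμ
    refine ge_of_tendsto (tendsto_Q3 r hS hlim (hapos β) f g h).abs ?_
    filter_upwards [hsize β Λ₆ hS] with k hk
    exact H3 β hβ (S k) hk

end Floors

end Summit.QuantumFields.YangMills.Theorems.InfiniteVolume

end
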